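import Summits.BirchSwinnertonDyer.Rank1Residual.SmallImageMu.GradedEulerLoss
import Summits.BirchSwinnertonDyer.Rank1Residual.SmallImageMu.EulerPrimitive
import HarnessLib
import HarnessLib.Audit

/-!
# Kernel glue of the graded Euler-loss nodes: ES-C4 ∧ B2 ⟹ S-es-3 (pure logic) — the decomposition of
# the crux's Euler-currency reading into DEPTH (ES-C4) and WIDTH (B2)

HONEST FRAMING (cell `bsd-f3-mu`).  THEOREMS ONLY, sorry-free; nothing booked.  Ported verbatim from
`HOME/es/Sketch4.lean` §3 (`fineMuLeEulerLoss_of_exponent_of_concentrated`).  With the gen-1 F1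
bookkeeping (`μ(X₀) ≤ δ_Kato ⟹ k ≤ 0`, MEMO-es §9) S-es-3 gives the crux `KatoDivisibilityOnClassX9`
(item stmt-BirchSwinnertonDyer-20547), so the crux reads ES-C4 («exponent», ported-theorem candidate)
∧ B2 («multiplicity», open).  The `n = 0` instance of ES-C4 / S-es-3 is the kernel core theorem
(`X10.coreTheoremAOddPrime_holds`; `EulerPrimitiveEdges.lean` (b3)); it is not restated here.

References: [Kato2004Asterisque] Thm. 13.4, §13.8; HOME MEMO-es.md §14–§18, REF1-AUDIT.md §3.3.
-/

-- the summit and its single problem are both named `BirchSwinnertonDyer` (registry layout D-0017)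
set_option linter.dupNamespace false

noncomputable section

open scoped Classical

open WeierstrassCurve Field Literature.NumberTheory.EllipticCurves
  Literature.NumberTheory.EllipticCurves.Kato2004
  Literature.NumberTheory.EllipticCurves.Kato2004.EulerSystemValues
  Summit.BirchSwinnertonDyer.BirchSwinnertonDyer.Rank1Residual

namespace Summit.BirchSwinnertonDyer.Rank1Residual.SmallImageMu

/-- **ES-C4 ∧ B2 ⟹ S-es-3 (pure logic)**: depth `≤ δ` and width `≤ 1` give `μ(X₀) ≤ δ`.
[cite: Kato2004Asterisque, Thm. 13.4 (p. 226) (shape of the graded bound)] -/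
theorem fineMuLeEulerLossOnClassX9_of_exponent_of_concentrated
    (h4 : FineExponentLeEulerLossOnClassX9) (hB : FineMuConcentratedOnClassX9) :
    FineMuLeEulerLossOnClassX9 :=
  fun W _ _ p _ _ _ _ κ γ I n hX9 hκ hγ hγ' hs Y ↦
    hB W p κ γ hX9 hκ hγ hγ' Y n (h4 W p κ γ I n hX9 hκ hγ hγ' hs Y)

/-- **Conjecture A on X9 ⟹ B2** (width `0 ≤ 1`): under DESC-A every finitely generated torsion fine
datum has `μ = 0` (T0, `Rank1Residual.ConjAAt.fineMuZeroAt` — carrier theorem), so `μ(X₀) = 0 ≤ n`;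
the finite-generation / torsion guards B2 lacks are supplied by the hypothesis `hY` (Kato Thm. 12.4 on
the scope; discharged from F1 + BCS (a) in `ConjARoadEdges.exists_fineSelmerDualData_finite_isTorsion`).
Recorded to make «B2 ⊊ Conj A∣X9» kernel-visible in the easy direction.
[cite: CoatesSujatha2005, Conjecture A (§3)] [cite: Washington1997, §13.2] -/
theorem fineMuConcentratedOnClassX9_of_conjAOnClassX9_of_guards
    (hA : ∀ (W : WeierstrassCurve ℚ) [W.IsElliptic] [W.IsGloballyMinimal] (p : ℕ) [Fact p.Prime],
      ClassX9 W p → Literature.NumberTheory.EllipticCurves.Rank1Residual.FineMuZeroAt W p)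
    (hY : ∀ (W : WeierstrassCurve ℚ) [W.IsElliptic] [W.IsGloballyMinimal] (p : ℕ) [Fact p.Prime]
      (κ : ZpExtension ℚ p) (γ : absoluteGaloisGroup ℚ), ClassX9 W p → κ.IsCyclotomic →
      κ.IsTopGenerator γ → IsCyclotomicVariable p γ → ∀ Y : W.FineSelmerDualData κ γ,
        Module.Finite (IwasawaAlgebra p) Y.X ∧ Module.IsTorsion (IwasawaAlgebra p) Y.X) :
    FineMuConcentratedOnClassX9 := by
  intro W _ _ p _ κ γ hX9 hκ hγ hγ' Y n _
  obtain ⟨hYf, hYt⟩ := hY W p κ γ hX9 hκ hγ hγ' Y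
  rw [hA W p hX9 κ γ hκ hγ hγ' Y hYf hYt]
  exact Nat.zero_le n

end Summit.BirchSwinnertonDyer.Rank1Residual.SmallImageMu

end
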